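import Summits.CriticalPhenomena.CardyFormulaZ2.Theorems.CardyComplexConeSLESixFamiliesGiveCardySmoothMarkFamiliesPart2
import Mathlib.Analysis.Calculus.LocalExtr.Basic
import Mathlib.Analysis.Calculus.Deriv.Slope
import Mathlib.Analysis.Calculus.Deriv.Pow
import HarnessLib

/-!
# drefute gen-7 — registered helper `smoothMark_part4` (STUB F, part 4/10): candidate proof

`smoothMark_part4` (registered 2026-08-16T05:15Z): in the monotone `1`-Lipschitz frame chart, two frame
points `P = (a, b)`, `P′ = (a′, b′)` with `a < a′`, `b ≤ b′` cannot share a nearest frontier point `q`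
lying in the chart.  Proof (Fermat): `q = (c, G c)` (frontier in the chart = graph, `frontier_coord`);
graph points near `q` are frontier points (`graph_mem_frontier`), so `c` is a local minimiser of
`c̃ ↦ (x - c̃)² + (y - G c̃)²` for both `(x, y) = P, P′`; the first-order conditions
`(x - c) + (y - G c) G′(c) = 0` subtract to `(a′ - a) + (b′ - b) G′(c) = 0`, impossible as
`G′(c) ≥ 0` (`Monotone.deriv_nonneg`).
-/

noncomputable section

open Set Metric Filter Topology
open Literature.Probability Literature.Probability.RandomPlanarGeometry
  Literature.Probability.LatticeModels

namespace Summit.CriticalPhenomena.CardyFormulaZ2.Cruxes.SLESixFamiliesGiveCardy.CollarTouchSandwich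
namespace DrefuteG7

section Chart

variable {k : Fin 2} {s t : ℤ} {U V : ℂ} (hs : s = 1 ∨ s = -1) (ht : t = 1 ∨ t = -1)
  (hU : U = Site.toComplex (Pi.single k s)) (hV : V = Site.toComplex (Pi.single k.rev t))
  {Ω : Set ℂ} {G : ℝ → ℝ} {p : ℂ} {R : ℝ} (hΩ : IsOpen Ω)
  (hLip : ∀ a b, |G a - G b| ≤ |a - b|)
  (hchart : ∀ a b : ℝ, dist ((a : ℂ) * U + (b : ℂ) * V) p < R → ((a : ℂ) * U + (b : ℂ) * V ∈ Ω ↔ G a < b))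

include hs ht hU hV in
/-- Frame coordinates of an arbitrary point. -/
theorem exists_frame_coord (z : ℂ) : ∃ c d : ℝ, z = (c : ℂ) * U + (d : ℂ) * V := by
  refine ⟨(z * (starRingEnd ℂ) U).re, (z * (starRingEnd ℂ) V).re, ?_⟩
  rw [hU, hV]
  exact frame_decomp k hs ht z

include hs ht hU hV hΩ hchart in
/-- Graph points inside the chart ball are frontier points. -/
theorem graph_mem_frontier {c : ℝ} (hc : dist ((c : ℂ) * U + ((G c : ℝ) : ℂ) * V) p < R) :
    (c : ℂ) * U + ((G c : ℝ) : ℂ) * V ∈ frontier Ω := by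
  rw [hΩ.frontier_eq]
  refine ⟨Metric.mem_closure_iff.2 fun ε hε => ?_, fun h => lt_irrefl _ ((hchart _ _ hc).1 h)⟩
  set η : ℝ := min (ε / 2) ((R - dist ((c : ℂ) * U + ((G c : ℝ) : ℂ) * V) p) / 2) with hη
  have hηpos : 0 < η := lt_min (by linarith) (by linarith)
  have hηε : η ≤ ε / 2 := min_le_left _ _
  have hηR : η ≤ (R - dist ((c : ℂ) * U + ((G c : ℝ) : ℂ) * V) p) / 2 := min_le_right _ _
  have hd : dist ((c : ℂ) * U + ((G c + η : ℝ) : ℂ) * V) ((c : ℂ) * U + ((G c : ℝ) : ℂ) * V) ≤ η := by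
    refine (SmoothMark.dist_le_abs_add_abs_frame hs ht hU hV _ _ _ _).trans ?_
    simp [abs_of_pos hηpos]
  refine ⟨(c : ℂ) * U + ((G c + η : ℝ) : ℂ) * V, (hchart _ _ ?_).2 (by linarith), ?_⟩
  · have := dist_triangle ((c : ℂ) * U + ((G c + η : ℝ) : ℂ) * V)
      ((c : ℂ) * U + ((G c : ℝ) : ℂ) * V) p
    linarith
  · rw [dist_comm]; linarith

include hs ht hU hV hΩ hLip hchart in
/-- A frontier point inside the chart ball lies on the graph. -/
theorem frontier_coord {c d : ℝ} (hq : (c : ℂ) * U + (d : ℂ) * V ∈ frontier Ω)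
    (hqp : dist ((c : ℂ) * U + (d : ℂ) * V) p < R) : d = G c := by
  rw [hΩ.frontier_eq] at hq
  rcases lt_trichotomy (G c) d with h | h | h
  · exact absurd ((hchart c d hqp).2 h) hq.2
  · exact h.symm
  · exfalso
    set ε : ℝ := min ((G c - d) / 2) (R - dist ((c : ℂ) * U + (d : ℂ) * V) p) with hε
    have hεpos : 0 < ε := lt_min (by linarith) (by linarith)
    obtain ⟨z, hz, hzq⟩ := Metric.mem_closure_iff.1 hq.1 ε hεpos
    obtain ⟨c', d', rfl⟩ := exists_frame_coord hs ht hU hV z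
    have hcd := SmoothMark.abs_sub_le_dist_frame hs ht hU hV c d c' d'
    have hzp : dist ((c' : ℂ) * U + (d' : ℂ) * V) p < R := by
      have := dist_triangle ((c' : ℂ) * U + (d' : ℂ) * V) ((c : ℂ) * U + (d : ℂ) * V) p
      have hε2 : ε ≤ R - dist ((c : ℂ) * U + (d : ℂ) * V) p := min_le_right _ _
      rw [dist_comm] at hzq
      linarith
    have hin : G c' < d' := (hchart c' d' hzp).1 hz
    have hε1 : ε ≤ (G c - d) / 2 := min_le_left _ _
    have h1 : |c - c'| < ε := hcd.1.trans_lt hzq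
    have h2 : |d - d'| < ε := hcd.2.trans_lt hzq
    have hG : G c - G c' < ε := ((le_abs_self _).trans (hLip c c')).trans_lt h1
    have h2' := (abs_lt.1 h2).1
    linarith

end Chart

/-- **`smoothMark_part4` verbatim (registered signature).** -/
theorem smoothMark_part4_proof : ∀ (Ω : Set ℂ) (k : Fin 2) (s t : ℤ) (U V : ℂ) (G : ℝ → ℝ) (α R : ℝ) (p : ℂ), (s = 1 ∨ s = -1) → (t = 1 ∨ t = -1) → U = Site.toComplex (Pi.single k s) → V = Site.toComplex (Pi.single k.rev t) → p = (α : ℂ) * U + ((G α : ℝ) : ℂ) * V → IsOpen Ω → (∀ a b, |G a - G b| ≤ |a - b|) → (∀ a b : ℝ, dist ((a : ℂ) * U + (b : ℂ) * V) p < R → ((a : ℂ) * U + (b : ℂ) * V ∈ Ω ↔ G a < b)) → Monotone G → (∀ c, |c - α| < R → DifferentiableAt ℝ G c) → ∀ (a b a' b' : ℝ), a < a' → b ≤ b' → ∀ q ∈ frontier Ω, dist ((a : ℂ) * U + (b : ℂ) * V) p + dist ((a : ℂ) * U + (b : ℂ) * V) q < R → dist ((a : ℂ) * U + (b : ℂ)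 * V) q = Metric.infDist ((a : ℂ) * U + (b : ℂ) * V) (frontier Ω) → dist ((a' : ℂ) * U + (b' : ℂ) * V) q = Metric.infDist ((a' : ℂ) * U + (b' : ℂ) * V) (frontier Ω) → False := by
  intro Ω k s t U V G α R p hs ht hU hV hp hΩ hLip hchart hmono hdiff a b a' b' haa' hbb' q hq hR hPq hP'q
  -- coordinates of `q`; `q` lies in the chart, on the graph
  obtain ⟨c, d, rfl⟩ := exists_frame_coord hs ht hU hV q
  have hqp : dist ((c : ℂ) * U + (d : ℂ) * V) p < R := by
    have := dist_triangle ((c : ℂ) * U + (d : ℂ) * V) ((a : ℂ) * U + (b : ℂ) * V) p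
    rw [dist_comm ((c : ℂ) * U + (d : ℂ) * V) ((a : ℂ) * U + (b : ℂ) * V)] at this
    linarith
  have hd : d = G c := frontier_coord hs ht hU hV hΩ hLip hchart hq hqp
  subst hd
  have hcα : |c - α| < R := by
    have h := (SmoothMark.abs_sub_le_dist_frame hs ht hU hV c (G c) α (G α)).1
    rw [← hp] at h
    exact h.trans_lt hqp
  have hGd : HasDerivAt G (deriv G c) c := (hdiff c hcα).hasDerivAt
  have hG' : 0 ≤ deriv G c := hmono.deriv_nonneg
  -- graph points near `c` are frontier points
  set ε : ℝ := (R - dist ((c : ℂ) * U + ((G c : ℝ) : ℂ) * V) p) / 2 with hε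
  have hεpos : 0 < ε := by rw [hε]; linarith
  have hfront : ∀ c' : ℝ, |c' - c| < ε → (c' : ℂ) * U + ((G c' : ℝ) : ℂ) * V ∈ frontier Ω := by
    intro c' hc'
    refine graph_mem_frontier hs ht hU hV hΩ hchart ?_
    have h1 := SmoothMark.dist_le_abs_add_abs_frame hs ht hU hV c' (G c') c (G c)
    have h2 : |G c' - G c| ≤ |c' - c| := hLip c' c
    have := dist_triangle ((c' : ℂ) * U + ((G c' : ℝ) : ℂ) * V) ((c : ℂ) * U + ((G c : ℝ) : ℂ) * V) p
    linarith
  -- Fermat at a point having `q` as a nearest frontier point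
  have fermat : ∀ x y : ℝ, dist ((x : ℂ) * U + (y : ℂ) * V) ((c : ℂ) * U + ((G c : ℝ) : ℂ) * V) =
      Metric.infDist ((x : ℂ) * U + (y : ℂ) * V) (frontier Ω) → (x - c) + (y - G c) * deriv G c = 0 := by
    intro x y hxy
    set f : ℝ → ℝ := fun c' => (x - c') ^ 2 + (y - G c') ^ 2 with hf
    have hfc' : ∀ c', f c' = dist ((x : ℂ) * U + (y : ℂ) * V) ((c' : ℂ) * U + ((G c' : ℝ) : ℂ) * V) ^ 2 :=
      fun c' => (SmoothMark.dist_sq_frame hs ht hU hV x y c' (G c')).symm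
    have hmin : IsLocalMin f c := by
      have hmem : Ioo (c - ε) (c + ε) ∈ 𝓝 c := isOpen_Ioo.mem_nhds ⟨by linarith, by linarith⟩
      filter_upwards [hmem] with c' hc'
      have hc'ε : |c' - c| < ε := abs_lt.2 ⟨by linarith [hc'.1], by linarith [hc'.2]⟩
      rw [hfc', hfc', hxy]
      have h0 : 0 ≤ Metric.infDist ((x : ℂ) * U + (y : ℂ) * V) (frontier Ω) := Metric.infDist_nonneg
      have h1 : Metric.infDist ((x : ℂ) * U + (y : ℂ) * V) (frontier Ω) ≤
          dist ((x : ℂ) * U + (y : ℂ) * V) ((c' : ℂ) * U + ((G c' : ℝ) : ℂ) * V) :=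
        Metric.infDist_le_dist_of_mem (hfront c' hc'ε)
      exact pow_le_pow_left₀ h0 h1 2
    have h1 : HasDerivAt (fun c' : ℝ => (x - c') ^ 2) (((2 : ℕ) : ℝ) * (x - c) ^ (2 - 1) * (-1)) c :=
      ((hasDerivAt_id c).const_sub x).pow 2
    have h2 : HasDerivAt (fun c' : ℝ => (y - G c') ^ 2) (((2 : ℕ) : ℝ) * (y - G c) ^ (2 - 1) * (-deriv G c)) c :=
      (hGd.const_sub y).pow 2
    have hderiv : HasDerivAt f
        (((2 : ℕ) : ℝ) * (x - c) ^ (2 - 1) * (-1) + ((2 : ℕ) : ℝ) * (y - G c) ^ (2 - 1) * (-deriv G c)) c := by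
      refine (h1.add h2).congr_of_eventuallyEq (Filter.Eventually.of_forall fun z => ?_)
      simp [hf]
    have h0 := hmin.hasDerivAt_eq_zero hderiv
    norm_num at h0
    linear_combination (-1 / 2 : ℝ) * h0
  have e1 := fermat a b hPq
  have e2 := fermat a' b' hP'q
  nlinarith [mul_nonneg (sub_nonneg.2 hbb') hG']

/-- **ORDER OF THE FEET (joint-sufficiency helper, not a registered stub).**  In the same chart, if
`P = (a, b)`, `P′ = (a′, b′)` with `a < a′`, `b ≤ b′` have nearest frontier points `q = (c, d)`,
`q′ = (c′, d′)` inside the chart, then `c < c′`: the feet are met in the same order as the columns.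
(`≤` is the monotonicity of ANY metric projection, `⟨P′ - P, q′ - q⟩ ≥ 0`, combined with `d = G c`,
`d′ = G c′`, `Monotone G`; `≠` is `smoothMark_part4`.)  This is the inequality that lets a frontier
CUT POINT strictly between the feet of the two endpoints of the column cut edge realise the column
split of the boundary sites through the distance rule `zdDiscreteArc`. -/
theorem foot_lt_foot (Ω : Set ℂ) (k : Fin 2) (s t : ℤ) (U V : ℂ) (G : ℝ → ℝ) (α R : ℝ) (p : ℂ)
    (hs : s = 1 ∨ s = -1) (ht : t = 1 ∨ t = -1) (hU : U = Site.toComplex (Pi.single k s))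
    (hV : V = Site.toComplex (Pi.single k.rev t)) (hp : p = (α : ℂ) * U + ((G α : ℝ) : ℂ) * V)
    (hΩ : IsOpen Ω) (hLip : ∀ a b, |G a - G b| ≤ |a - b|)
    (hchart : ∀ a b : ℝ, dist ((a : ℂ) * U + (b : ℂ) * V) p < R → ((a : ℂ) * U + (b : ℂ) * V ∈ Ω ↔ G a < b))
    (hmono : Monotone G) (hdiff : ∀ c, |c - α| < R → DifferentiableAt ℝ G c)
    {a b a' b' c d c' d' : ℝ} (haa' : a < a') (hbb' : b ≤ b')
    (hq : (c : ℂ) * U + (d : ℂ) * V ∈ frontier Ω) (hq' : (c' : ℂ) * U + (d' : ℂ) * V ∈ frontier Ω)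
    (hR : dist ((a : ℂ) * U + (b : ℂ) * V) p + dist ((a : ℂ) * U + (b : ℂ) * V) ((c : ℂ) * U + (d : ℂ) * V) < R)
    (hq'p : dist ((c' : ℂ) * U + (d' : ℂ) * V) p < R)
    (hPq : dist ((a : ℂ) * U + (b : ℂ) * V) ((c : ℂ) * U + (d : ℂ) * V) =
      Metric.infDist ((a : ℂ) * U + (b : ℂ) * V) (frontier Ω))
    (hP'q' : dist ((a' : ℂ) * U + (b' : ℂ) * V) ((c' : ℂ) * U + (d' : ℂ) * V) =
      Metric.infDist ((a' : ℂ) * U + (b' : ℂ) * V) (frontier Ω)) :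
    c < c' := by
  -- both feet are graph points
  have hqp : dist ((c : ℂ) * U + (d : ℂ) * V) p < R := by
    have := dist_triangle ((c : ℂ) * U + (d : ℂ) * V) ((a : ℂ) * U + (b : ℂ) * V) p
    rw [dist_comm ((c : ℂ) * U + (d : ℂ) * V) ((a : ℂ) * U + (b : ℂ) * V)] at this
    linarith
  have hd : d = G c := frontier_coord hs ht hU hV hΩ hLip hchart hq hqp
  have hd' : d' = G c' := frontier_coord hs ht hU hV hΩ hLip hchart hq' hq'p
  -- monotonicity of the metric projection: `(c' - c)(a' - a) + (d' - d)(b' - b) ≥ 0`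
  have h1 : dist ((a : ℂ) * U + (b : ℂ) * V) ((c : ℂ) * U + (d : ℂ) * V) ≤
      dist ((a : ℂ) * U + (b : ℂ) * V) ((c' : ℂ) * U + (d' : ℂ) * V) := by
    rw [hPq]; exact Metric.infDist_le_dist_of_mem hq'
  have h2 : dist ((a' : ℂ) * U + (b' : ℂ) * V) ((c' : ℂ) * U + (d' : ℂ) * V) ≤
      dist ((a' : ℂ) * U + (b' : ℂ) * V) ((c : ℂ) * U + (d : ℂ) * V) := by
    rw [hP'q']; exact Metric.infDist_le_dist_of_mem hq
  have h1' := pow_le_pow_left₀ dist_nonneg h1 2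
  have h2' := pow_le_pow_left₀ dist_nonneg h2 2
  rw [SmoothMark.dist_sq_frame hs ht hU hV, SmoothMark.dist_sq_frame hs ht hU hV] at h1' h2'
  have hproj : 0 ≤ (c' - c) * (a' - a) + (d' - d) * (b' - b) := by nlinarith
  -- hence `c ≤ c'` by monotonicity of `G` ...
  have hle : c ≤ c' := by
    by_contra hlt
    push Not at hlt
    have hG : G c' ≤ G c := hmono hlt.le
    rw [hd, hd'] at hproj
    nlinarith
  -- ... and `c ≠ c'` by `smoothMark_part4`
  rcases hle.lt_or_eq with h | h
  · exact h
  · exfalso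
    subst h
    have hdd : d' = d := by rw [hd, hd']
    subst hdd
    exact smoothMark_part4_proof Ω k s t U V G α R p hs ht hU hV hp hΩ hLip hchart hmono hdiff a b a' b'
      haa' hbb' _ hq hR hPq hP'q'

end DrefuteG7
end Summit.CriticalPhenomena.CardyFormulaZ2.Cruxes.SLESixFamiliesGiveCardy.CollarTouchSandwich

end
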